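/-
Copyright: public-domain mathematics; typed transcription for the H21 Literature library (cell lit-balaban,
Phase-2 proof seat p38 gen 7 = literature-prover-lit-balaban-p38-g7-0).

statement-level skeleton of published theorems with citation tags; proofs where landed; nothing here is a claim about the Yang–Mills mass gap

# Bałaban, *Propagators and renormalization transformations for lattice gauge theories. I*,
# Commun. Math. Phys. **95** (1984) 17–40 — the real torus containing `T_η = Tor (fine n M)` and the CENTRES of the cube cover `□_z`
# AT SCALE `M₀` (p. 36), with the multiplicity and row-sum geometry the random walk (1.123)–(1.131) consumes

[cite: Balaban1984PropagatorsI]  T. Bałaban, Commun. Math. Phys. 95 (1984) 17–40.  p. 36 (PDF p. 20), verbatim (OCR layer of the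
held scan `paper:balaban1984-cmp95-propagators-rt-i`, p0020, ll. 25–32): «Instead we construct a random walk representation of the
kind described in [2]. Such representations will be our basic tool in investigation of more complicated operators. We consider the
lattice of cubes of size M₀, M₀ = L^{m₀}, defined by the lattice T^{(k+m₀)}_{M₀}, and cubes □_z of size 2M₀ and with a center at the
point z ∈ T^{(k+m₀)}_{M₀}. These cubes cover the lattice T_η. We construct a partition of unity taking the functions
[h_z(x) = Π_{μ=1}^d h((x_μ − z_μ)/M₀), h ∈ C₀^∞(]−⅔, ⅔[) — display, reconstructed from the formula layer] h(t) = 1 for t ∈ [−⅓, ⅓],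
h is chosen in such a way that Σ_n h²(t − n) = 1, hence Σ_z h_z²(x) = 1. (1.118)»; p. 38 [PDF 22]: «(1.126) gives a bound with a small
factor O(M₀⁻¹) and the exponential factor e^{−⅓δ′₀M₀|z′₁−z′₂|} … Defining 2δ₀ = min{⅓δ′₀, M₀⁻¹}, we obtain
|h_{z₁}K(h_{z₂})A| ≤ O(M₀⁻¹)e^{−2δ₀|z₁−z₂|}(|∇A| + |A|). (1.128)»; p. 38 (1.131) (the walk-sum display with the factor
Σ_{z′} e^{−δ₀|z−z′|} under the sum) and p. 39 [PDF 23]: «Let us notice that the constant O(1) under the sum above is an absolute constant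
depending on d only, hence we can fix M₀ depending on d only, such that the series is convergent.»  OURS (not printed, an evaluation of
that O(1) used by `B5Local114`/`B5Walk131`): the factor can be taken `≤ ν·sup_z Σ_{z′} e^{−δ₀|z−z′|}` with `ν` = the number of cubes
`□_z` near a point and the row sum `Σ_{x∈Z^d} e^{−δ₀M₀|x|}` — the two quantities this module bounds.

WHAT THIS MODULE ADDS (SKELETON rows B5.Eq1.118–B5.Eq1.131 / B5.Prop1.2, owner r02; GAPS G-B5-03 = the printed RANDOM-WALK route
for G, so far un-inhabited on the torus — see `B5Local114.Realisation`, pub-balaban B05 gen 4).  The abstract walk machine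
`B5Local114` needs, per instance and cube scale `M₀ ≥ 1`: a pseudometric carrier `X` ⊇ `T_η` dominating the unit-lattice distance,
finitely many centres `z` with points `ctr z ∈ X`, real multipliers `h_z` with `Σ_z h_z² = 1`, `|h_z| ≤ 1`, supports of radius
`O(M₀)`, Lipschitz constant `O(M₀⁻¹)` and lattice Laplacian `O(M₀⁻²)` (the data behind «∂h = O(M₀⁻¹)», (1.121)/(1.128)), at most `ν`
cubes through a point and the row sums «Σ_{z′} e^{−δ₀|z−z′|}» bounded uniformly.  We CONSTRUCT them for r02's torus of record
`Tor (fine n M)` (`η = 1/n`, unit periods `M_μ`) at EVERY `M₀ ≥ 1` and EVERY torus, with constants depending on `d` only: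
* §1 `TorR M` — the real torus `ℝ^d/(M_μℤ)_μ` with the sup circular distance `dist u v = max_μ |crep_{M_μ}(u_μ − v_μ)|` (a
  `PseudoMetricSpace`), the embeddings `ucPt x = (x_μ/n)_μ` of fine sites and `sitePt y = (y_μ)_μ` of unit sites, and the dictionary
  `dist (ucPt x) (ucPt x′) ≤ distU x x′`, `distSite y y′ ≤ dist (sitePt y) (sitePt y′)`, `x ∈ Δ̃(y) ⇒ dist (ucPt x) (sitePt y) ≤ 1`;
* §2 the CENTRES at scale `M₀`: `nCtr M M₀ μ = max 1 ⌈M_μ/M₀⌉` centres on the axis `μ`, spacing `sp μ = M_μ/nCtr μ` (`= M₀` exactly in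
  the printed situation `M₀ ∣ M_μ`, i.e. `z ∈ T^{(k+m₀)}_{M₀}`; in general `sp ∈ [M₀/2, M₀]`, and ONE centre with the constant profile on
  an axis shorter than `M₀` — the abstract interface quantifies over all `M₀ ≥ 1`, the paper only over `M₀ = L^{m₀}` dividing the side),
  `Cen M M₀ = Π_μ Fin (nCtr μ)`, `ctr z = (z_μ·sp μ)_μ ∈ TorR M`, the comparison `tdist z z′ ≤ (2/M₀)·dist (ctr z) (ctr z′)`, the
  MULTIPLICITY `#{z : dist u (ctr z) ≤ c̄M₀} ≤ (8c̄ + 1)^d` (`card_near_ctr_le`) and the ROW SUMS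
  `Σ_{z′} e^{−dist(ctr z, ctr z′)/(2M₀)} ≤ K_d(¼)` (`rowSum_ctr_le`; `K_d = B4Sect5Proof.latticeConst`);
Consumers: `B5WalkPartitionTorus` (the functions `h_z` of (1.118) on this carrier), `B5WalkCarrierTorus` / `B5WalkH128Torus` /
`B5WalkRealisationTorus` (this seat), which inhabit `B5Local114.Realisation` for
`B5SettingP12Real.latticeSettingP12R`.

HONEST SCOPE.  Lattice geometry only; no operator of the paper enters.  Constants ours (the paper prints O(1)'s).  DEVIATION (forced by
the interface `∀ M₀ ≥ 1`, every torus): centre spacing `M_μ/⌈M_μ/M₀⌉ ∈ [M₀/2, M₀]` instead of exactly `M₀`; equal to the print when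
`M₀ ∣ M_μ`.  value = located leaves (1.118) + p. 36/38 cube geometry for the torus of record — NOT summit progress.
-/
import Mathlib
import Literature.MathematicalPhysics.QuantumFieldTheory.Balaban1983to89.B5CoverP12Lattice

open scoped BigOperators Real
open Finset

namespace Literature.MathematicalPhysics.QuantumFieldTheory.Balaban1983to89.B5WalkTorusGeom

open Literature.MathematicalPhysics.QuantumFieldTheory.Balaban1983to89
open Literature.MathematicalPhysics.QuantumFieldTheory.Balaban1983to89.B5Prop11Plancherel (Tor fine)
open Literature.MathematicalPhysics.QuantumFieldTheory.Balaban1983to89.B5Prop12FieldsLattice (cdistF distU distSite toFine cubeT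
  distU_nonneg)
open Literature.MathematicalPhysics.QuantumFieldTheory.Balaban1983to89.B4TorusKernel.MultiPeriod (circAbs circAbs_nonneg)
open Literature.MathematicalPhysics.QuantumFieldTheory.Balaban1983to89.B4Sect5Torus (TSite ccoord tdist ccoord_cast circAbs_zero)
open Literature.MathematicalPhysics.QuantumFieldTheory.Balaban1983to89.B4Sect5Proof (latticeConst latticeConst_nonneg)
open Literature.MathematicalPhysics.QuantumFieldTheory.Balaban1983to89.B5TorusCover (rowSum_finset_le ballCard_le_real)
open Literature.MathematicalPhysics.QuantumFieldTheory.Balaban1983to89.B4PartitionUnity22 (hprof hprof_nonneg hprof_le_one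
  contDiff_hprof hasCompactSupport_hprof D1 D2 D1_nonneg D2_nonneg abs_second_diff_le_D2)
open Literature.MathematicalPhysics.QuantumFieldTheory.Balaban1983to89.B5Partition118Printed (crep abs_crep_le abs_crep_le_abs_sub
  crep_eq_sub crep_add_int_mul crep_eq_self hper hper_nonneg hper_le_one hper_eq_zero hper_local sum_hper_sq natMul_abs_crep_eq_circAbs)
open Literature.MathematicalPhysics.QuantumFieldTheory.Balaban1983to89.B5CoverP12Lattice (ProfileData profileData_hprof per hper_eq_per
  per_lipschitz abs_crep_add_le abs_crep_neg abs_crep_le_abs abs_prod_sub_prod_le uc cdistF_eq_mul_abs_crep cdistF_le_mul_distU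
  abs_crep_uc_sub_le_distU mem_cubeT_iff_crep Lw Lw_nonneg)
open Literature.MathematicalPhysics.QuantumFieldTheory.Balaban1983to89.B5Ineq110P12Lattice (natAbs_valMinAbs_intCast_sub)
open Literature.MathematicalPhysics.QuantumFieldTheory.Balaban1983to89.B6Cov2156Torus (one_le_M)

noncomputable section

variable {d : ℕ}

/-! ## §1 The real torus `ℝ^d/(M_μℤ)` with the sup circular distance; fine sites and unit sites inside it -/

section RealTorus

variable (M : Fin d → ℕ)

/-- the unit periods are positive reals. [cite: Balaban1984PropagatorsI, p.35 (T₁^{(k)})] -/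
theorem period_pos [hM : ∀ μ, NeZero (M μ)] (μ : Fin d) : (0 : ℝ) < (M μ : ℝ) := by exact_mod_cast one_le_M M μ

/-- `crep P 0 = 0`. (plumbing of the printed torus partition) [cite: Balaban1984PropagatorsI, (1.118) p.36] -/
theorem crep_zero (P : ℝ) : crep P 0 = 0 := by simp [crep]

/-- **the real torus `T = ℝ^d/(M_μℤ)_μ` ⊇ `T_η ⊇ T₁^{(k)}`** as a carrier type (points given by lifted coordinates `c ∈ ℝ^d`; the `X`
of `B5Local114.Realisation` for the torus of record). [cite: Balaban1984PropagatorsI, p.36 («These cubes cover the lattice T_η»)] -/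
structure TorR (M : Fin d → ℕ) : Type where
  /-- lifted coordinates -/
  c : Fin d → ℝ

namespace TorR

/-- the circular distance of the `μ`-th coordinates, `|crep_{M_μ}(u_μ − v_μ)| ≥ 0`, as a nonnegative real.
[cite: Balaban1984PropagatorsI, (1.109) p.35 (|x − x′|)] -/
def cdistNN (u v : TorR M) (μ : Fin d) : NNReal := ⟨|crep (M μ) (u.c μ - v.c μ)|, abs_nonneg _⟩

/-- **the sup circular distance** `max_μ |crep_{M_μ}(u_μ − v_μ)|` (`0` for `d = 0`). [cite: Balaban1984PropagatorsI, (1.109) p.35 (|x − x′|)] -/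
def rdist (u v : TorR M) : ℝ := ((Finset.univ.sup (cdistNN M u v) : NNReal) : ℝ)

/-- each coordinate circular distance is below the sup distance. [cite: Balaban1984PropagatorsI, (1.109) p.35] -/
theorem cdist_le_rdist (u v : TorR M) (μ : Fin d) : |crep (M μ) (u.c μ - v.c μ)| ≤ rdist M u v := by
  have h : cdistNN M u v μ ≤ Finset.univ.sup (cdistNN M u v) := Finset.le_sup (Finset.mem_univ μ)
  show ((cdistNN M u v μ : NNReal) : ℝ) ≤ ((Finset.univ.sup (cdistNN M u v) : NNReal) : ℝ)
  exact NNReal.coe_le_coe.mpr h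

/-- the sup distance is below any common bound of the coordinate distances. [cite: Balaban1984PropagatorsI, (1.109) p.35] -/
theorem rdist_le_of_forall {u v : TorR M} {r : ℝ} (hr : 0 ≤ r) (h : ∀ μ, |crep (M μ) (u.c μ - v.c μ)| ≤ r) :
    rdist M u v ≤ r := by
  have h' : Finset.univ.sup (cdistNN M u v) ≤ (⟨r, hr⟩ : NNReal) :=
    Finset.sup_le fun μ _ => show (cdistNN M u v μ : NNReal) ≤ ⟨r, hr⟩ from NNReal.coe_le_coe.mp (h μ)
  show ((Finset.univ.sup (cdistNN M u v) : NNReal) : ℝ) ≤ ((⟨r, hr⟩ : NNReal) : ℝ)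
  exact NNReal.coe_le_coe.mpr h'

/-- `0 ≤ rdist`. [cite: Balaban1984PropagatorsI, (1.109) p.35] -/
theorem rdist_nonneg (u v : TorR M) : 0 ≤ rdist M u v := by unfold rdist; exact NNReal.coe_nonneg _

variable [hM : ∀ μ, NeZero (M μ)]

/-- **the real torus is a pseudometric space** for the sup circular distance. [cite: Balaban1984PropagatorsI, (1.109) p.35 (|x − x′|)] -/
instance : PseudoMetricSpace (TorR M) where
  dist := rdist M
  dist_self u := by
    apply le_antisymm _ (rdist_nonneg M u u)
    exact rdist_le_of_forall M le_rfl fun μ => by rw [sub_self, crep_zero, abs_zero]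
  dist_comm u v := by
    have key : ∀ u v : TorR M, rdist M u v ≤ rdist M v u := fun u v =>
      rdist_le_of_forall M (rdist_nonneg M v u) fun μ => by
        rw [show u.c μ - v.c μ = -(v.c μ - u.c μ) by ring, abs_crep_neg (period_pos M μ)]
        exact cdist_le_rdist M v u μ
    exact le_antisymm (key u v) (key v u)
  dist_triangle u v w := by
    refine rdist_le_of_forall M (add_nonneg (rdist_nonneg M u v) (rdist_nonneg M v w)) fun μ => ?_
    calc |crep (M μ) (u.c μ - w.c μ)| = |crep (M μ) ((u.c μ - v.c μ) + (v.c μ - w.c μ))| := by ring_nf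
      _ ≤ |crep (M μ) (u.c μ - v.c μ)| + |crep (M μ) (v.c μ - w.c μ)| := abs_crep_add_le (period_pos M μ) _ _
      _ ≤ rdist M u v + rdist M v w := add_le_add (cdist_le_rdist M u v μ) (cdist_le_rdist M v w μ)

/-- `dist = rdist`. [cite: Balaban1984PropagatorsI, (1.109) p.35] -/
theorem dist_eq (u v : TorR M) : dist u v = rdist M u v := rfl

/-- a coordinate circular distance is below the distance. [cite: Balaban1984PropagatorsI, (1.109) p.35] -/
theorem abs_crep_sub_le_dist (u v : TorR M) (μ : Fin d) : |crep (M μ) (u.c μ - v.c μ)| ≤ dist u v :=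
  cdist_le_rdist M u v μ

/-- the distance is below any common bound of the coordinate circular distances. [cite: Balaban1984PropagatorsI, (1.109) p.35] -/
theorem dist_le_of_forall {u v : TorR M} {r : ℝ} (hr : 0 ≤ r) (h : ∀ μ, |crep (M μ) (u.c μ - v.c μ)| ≤ r) :
    dist u v ≤ r :=
  rdist_le_of_forall M hr h

/-- the point with one coordinate shifted: `u + t·e_μ`. [cite: Balaban1984PropagatorsI, (1.121) p.37 (∂h)] -/
def shift (u : TorR M) (μ : Fin d) (t : ℝ) : TorR M := ⟨Function.update u.c μ (u.c μ + t)⟩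

omit hM in
/-- coordinates of a shifted point. [cite: Balaban1984PropagatorsI, (1.121) p.37] -/
theorem shift_c_self (u : TorR M) (μ : Fin d) (t : ℝ) : (shift M u μ t).c μ = u.c μ + t := by
  simp [shift]

omit hM in
/-- coordinates of a shifted point. [cite: Balaban1984PropagatorsI, (1.121) p.37] -/
theorem shift_c_of_ne (u : TorR M) {μ ν : Fin d} (h : ν ≠ μ) (t : ℝ) : (shift M u μ t).c ν = u.c ν := by
  simp [shift, Function.update_of_ne h]

/-- shifting one coordinate by `t` moves a point by at most `|t|`. [cite: Balaban1984PropagatorsI, (1.109) p.35] -/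
theorem dist_shift_le (u : TorR M) (μ : Fin d) (t : ℝ) : dist (shift M u μ t) u ≤ |t| := by
  refine dist_le_of_forall M (abs_nonneg t) fun ν => ?_
  by_cases h : ν = μ
  · subst h
    rw [shift_c_self, show u.c ν + t - u.c ν = t by ring]
    exact abs_crep_le_abs (period_pos M ν) t
  · rw [shift_c_of_ne M u h, sub_self, crep_zero, abs_zero]
    exact abs_nonneg t

end TorR

open TorR

variable [hM : ∀ μ, NeZero (M μ)] (n : ℕ) [NeZero n]

/-- **a fine site `x ∈ T_η` as a point of the real torus**: `(x_μ/n)_μ`. [cite: Balaban1984PropagatorsI, p.35 (T_η)] -/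
def ucPt (x : Tor (fine n M)) : TorR M := ⟨fun μ => uc M n x μ⟩

omit hM in
/-- **a unit-lattice point `y ∈ T₁^{(k)}` as a point of the real torus**: `(y_μ)_μ`. [cite: Balaban1984PropagatorsI, p.35 (T₁^{(k)})] -/
def sitePt (y : Tor M) : TorR M := ⟨fun μ => ((y μ).val : ℝ)⟩

omit hM [NeZero n] in
/-- coordinates of `ucPt`. [cite: Balaban1984PropagatorsI, p.35] -/
@[simp] theorem ucPt_c (x : Tor (fine n M)) (μ : Fin d) : (ucPt M n x).c μ = uc M n x μ := rfl

omit hM in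
/-- coordinates of `sitePt`. [cite: Balaban1984PropagatorsI, p.35] -/
@[simp] theorem sitePt_c (y : Tor M) (μ : Fin d) : (sitePt M y).c μ = ((y μ).val : ℝ) := rfl

/-- **`dist (ucPt x) (ucPt x′) ≤ distU x x′`** (in fact equal): the embedding of `T_η` does not increase distances.
[cite: Balaban1984PropagatorsI, (1.109) p.35 (|x − x′|)] -/
theorem dist_ucPt_le_distU (hn : 1 ≤ n) (x x' : Tor (fine n M)) : dist (ucPt M n x) (ucPt M n x') ≤ distU n M x x' :=
  dist_le_of_forall M (distU_nonneg x x') fun μ => abs_crep_uc_sub_le_distU M n hn x x' μ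

omit hM [NeZero n] in
/-- `|crep_{P}(a)| = dist(a, Pℤ)` for integers: the circular distance of r02's unit lattice. (plumbing) [cite: Balaban1984PropagatorsI, (1.109) p.35] -/
theorem abs_crep_intCast_eq_circAbs {P : ℕ} (hP : 1 ≤ P) (a : ℤ) : |crep (P : ℝ) (a : ℝ)| = (circAbs P a : ℝ) := by
  have h := natMul_abs_crep_eq_circAbs (M₀ := 1) (P := P) le_rfl hP a
  simpa using h

/-- **`distSite y y′ ≤ dist (sitePt y) (sitePt y′)`** (in fact equal): the field `hdist` of `B5Local114.Realisation` for the setting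
of record with `X := TorR M`. [cite: Balaban1984PropagatorsI, Prop. 1.2 (1.110) p.35 (|y − y′|)] -/
theorem distSite_le_dist_sitePt (y y' : Tor M) : distSite M y y' ≤ dist (sitePt M y) (sitePt M y') := by
  unfold distSite
  rcases isEmpty_or_nonempty (Fin d) with hd | hd
  · rw [Finset.univ_eq_empty, Finset.sup_empty, bot_eq_zero, Nat.cast_zero]
    exact dist_nonneg
  · obtain ⟨μ, -, hμ⟩ := Finset.exists_mem_eq_sup (Finset.univ : Finset (Fin d)) Finset.univ_nonempty
      (fun μ => ((y μ - y' μ).valMinAbs).natAbs)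
    rw [hμ]
    have h2 : ((((y μ - y' μ).valMinAbs).natAbs : ℕ) : ℤ) = circAbs (M μ) (((y μ).val : ℤ) - ((y' μ).val : ℤ)) := by
      have h1 := natAbs_valMinAbs_intCast_sub (N := M μ) ((y μ).val : ℤ) ((y' μ).val : ℤ)
      simpa only [Int.cast_natCast, ZMod.natCast_zmod_val] using h1
    have h4 := abs_crep_intCast_eq_circAbs (one_le_M M μ) (((y μ).val : ℤ) - ((y' μ).val : ℤ))
    push_cast at h4
    calc ((((y μ - y' μ).valMinAbs).natAbs : ℕ) : ℝ) = (((((y μ - y' μ).valMinAbs).natAbs : ℕ) : ℤ) : ℝ) :=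
          (Int.cast_natCast _).symm
      _ = ((circAbs (M μ) (((y μ).val : ℤ) - ((y' μ).val : ℤ)) : ℤ) : ℝ) := by rw [h2]
      _ = |crep (M μ) ((sitePt M y).c μ - (sitePt M y').c μ)| := by rw [sitePt_c, sitePt_c, h4]
      _ ≤ dist (sitePt M y) (sitePt M y') := abs_crep_sub_le_dist M _ _ μ

/-- **`x ∈ Δ̃(y) ⇒ dist (ucPt x) (sitePt y) ≤ 1`** («cubes of size 2 and with a center at y», p. 35).
[cite: Balaban1984PropagatorsI, p.35 (the cubes Δ̃(y))] -/
theorem dist_ucPt_sitePt_le_one (hn : 1 ≤ n) {x : Tor (fine n M)} {y : Tor M} (h : x ∈ cubeT n M y) :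
    dist (ucPt M n x) (sitePt M y) ≤ 1 :=
  dist_le_of_forall M zero_le_one fun μ => (mem_cubeT_iff_crep M n hn x y).mp h μ

end RealTorus

/-! ## §2 The centres of the cubes `□_z` at scale `M₀` -/

section Centres

open TorR

variable (M : Fin d → ℕ) [hM : ∀ μ, NeZero (M μ)] (M₀ : ℕ)

/-- **number of centres on the axis `μ`**: `max 1 ⌈M_μ/M₀⌉` (`= M_μ/M₀` in the printed situation `M₀ ∣ M_μ`, `M₀ ≤ M_μ`).
[cite: Balaban1984PropagatorsI, p.36 (z ∈ T^{(k+m₀)}_{M₀})] -/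
def nCtr (μ : Fin d) : ℕ := max 1 ⌈(M μ : ℝ) / M₀⌉₊

omit hM in
/-- `1 ≤ nCtr`. [cite: Balaban1984PropagatorsI, p.36] -/
theorem one_le_nCtr (μ : Fin d) : 1 ≤ nCtr M M₀ μ := le_max_left _ _

omit hM in
/-- the number of centres on an axis is never zero. [cite: Balaban1984PropagatorsI, p.36] -/
instance (μ : Fin d) : NeZero (nCtr M M₀ μ) := ⟨by have := one_le_nCtr M M₀ μ; omega⟩

/-- **the centre set** `Π_μ ℤ/nCtr_μ ℤ` (the index torus of `T^{(k+m₀)}_{M₀}`). [cite: Balaban1984PropagatorsI, p.36 (z ∈ T^{(k+m₀)}_{M₀})] -/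
abbrev Cen : Type := TSite d (nCtr M M₀)

/-- **the spacing of the centres on the axis `μ`**: `M_μ/nCtr_μ` (`= M₀` when `M₀ ∣ M_μ`). [cite: Balaban1984PropagatorsI, p.36] -/
def sp (μ : Fin d) : ℝ := (M μ : ℝ) / nCtr M M₀ μ

omit hM in
/-- `0 < nCtr` as a real. [cite: Balaban1984PropagatorsI, p.36] -/
theorem nCtr_pos (μ : Fin d) : (0 : ℝ) < (nCtr M M₀ μ : ℝ) := by exact_mod_cast one_le_nCtr M M₀ μ

/-- `0 < sp`. [cite: Balaban1984PropagatorsI, p.36] -/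
theorem sp_pos (μ : Fin d) : 0 < sp M M₀ μ := div_pos (period_pos M μ) (nCtr_pos M M₀ μ)

omit hM in
/-- `nCtr · sp = M`: the centres tile the axis exactly. [cite: Balaban1984PropagatorsI, p.36] -/
theorem nCtr_mul_sp (μ : Fin d) : (nCtr M M₀ μ : ℝ) * sp M M₀ μ = M μ := by
  unfold sp
  rw [mul_div_assoc']
  exact mul_div_cancel_left₀ _ (nCtr_pos M M₀ μ).ne'

variable {M₀}

omit hM in
/-- `sp ≤ M₀` (for `M₀ ≥ 1`). [cite: Balaban1984PropagatorsI, p.36 (cubes of size 2M₀)] -/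
theorem sp_le (hM₀ : 1 ≤ M₀) (μ : Fin d) : sp M M₀ μ ≤ M₀ := by
  have hM0 : (0 : ℝ) < M₀ := by exact_mod_cast hM₀
  unfold sp
  rw [div_le_iff₀ (nCtr_pos M M₀ μ)]
  have h1 : (M μ : ℝ) / M₀ ≤ ⌈(M μ : ℝ) / M₀⌉₊ := Nat.le_ceil _
  have h2 : (⌈(M μ : ℝ) / M₀⌉₊ : ℝ) ≤ (nCtr M M₀ μ : ℝ) := by
    unfold nCtr; exact_mod_cast le_max_right _ _
  rw [div_le_iff₀ hM0] at h1
  nlinarith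

omit hM in
/-- if there is only one centre on an axis, that axis is at most `M₀` long. [cite: Balaban1984PropagatorsI, p.36] -/
theorem period_le_of_nCtr_eq_one (hM₀ : 1 ≤ M₀) {μ : Fin d} (h : nCtr M M₀ μ = 1) : (M μ : ℝ) ≤ M₀ := by
  have := sp_le M hM₀ μ
  rw [sp, h, Nat.cast_one, div_one] at this
  exact this

omit hM in
/-- `M₀/2 ≤ sp` on every axis carrying at least two centres. [cite: Balaban1984PropagatorsI, p.36] -/
theorem half_le_sp (hM₀ : 1 ≤ M₀) {μ : Fin d} (h : 2 ≤ nCtr M M₀ μ) : (M₀ : ℝ) / 2 ≤ sp M M₀ μ := by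
  have hM0 : (0 : ℝ) < M₀ := by exact_mod_cast hM₀
  have hceil : nCtr M M₀ μ = ⌈(M μ : ℝ) / M₀⌉₊ := by
    unfold nCtr at h ⊢
    have : 1 ≤ ⌈(M μ : ℝ) / M₀⌉₊ := by
      by_contra hc
      rw [not_le] at hc
      rw [max_eq_left (by omega : ⌈(M μ : ℝ) / M₀⌉₊ ≤ 1)] at h
      omega
    exact max_eq_right this
  -- `⌈M/M₀⌉ < M/M₀ + 1`
  have hlt : (nCtr M M₀ μ : ℝ) < (M μ : ℝ) / M₀ + 1 := by
    rw [hceil]; exact Nat.ceil_lt_add_one (by positivity)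
  have h2 : (2 : ℝ) ≤ nCtr M M₀ μ := by exact_mod_cast h
  -- hence `M > M₀`
  have hMgt : (M₀ : ℝ) < M μ := by
    have : (1 : ℝ) < (M μ : ℝ) / M₀ := by linarith
    rwa [lt_div_iff₀ hM0, one_mul] at this
  unfold sp
  rw [div_le_div_iff₀ (by norm_num : (0:ℝ) < 2) (nCtr_pos M M₀ μ)]
  have : (nCtr M M₀ μ : ℝ) * M₀ < M μ + M₀ := by
    have := mul_lt_mul_of_pos_right hlt hM0
    rwa [add_mul, div_mul_cancel₀ _ hM0.ne', one_mul] at this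
  nlinarith

variable (M₀)

/-- **the centre point `ctr z = (z_μ · sp μ)_μ ∈ TorR M`**. [cite: Balaban1984PropagatorsI, p.36 («with a center at the point z ∈ T^{(k+m₀)}_{M₀}»)] -/
def ctr (z : Cen M M₀) : TorR M := ⟨fun μ => ((z μ).val : ℝ) * sp M M₀ μ⟩

omit hM in
/-- coordinates of `ctr`. [cite: Balaban1984PropagatorsI, p.36] -/
@[simp] theorem ctr_c (z : Cen M M₀) (μ : Fin d) : (ctr M M₀ z).c μ = ((z μ).val : ℝ) * sp M M₀ μ := rfl

omit hM in
/-- scaling of the centred representative: `crep_{P·s}(t·s) = s·crep_P(t)` (`s > 0`). (plumbing) [cite: Balaban1984PropagatorsI, (1.118) p.36] -/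
theorem crep_mul_scale {P s : ℝ} (hs : 0 < s) (t : ℝ) : crep (P * s) (t * s) = s * crep P t := by
  unfold crep
  rw [show t * s / (P * s) = t / P by rw [mul_div_mul_right _ _ hs.ne']]
  ring

/-- the circular coordinate distance of two centres is the spacing times the index distance:
`|crep_{M_μ}((z_μ − z′_μ)·sp μ)| = sp μ · dist(z_μ − z′_μ, nCtr_μ ℤ)`. [cite: Balaban1984PropagatorsI, p.36 (|z₁ − z₂|)] -/
theorem cdist_ctr_eq (z z' : Cen M M₀) (μ : Fin d) :
    |crep (M μ) ((ctr M M₀ z).c μ - (ctr M M₀ z').c μ)|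
      = sp M M₀ μ * (circAbs (nCtr M M₀ μ) (((z μ).val : ℤ) - ((z' μ).val : ℤ)) : ℝ) := by
  rw [ctr_c, ctr_c, ← sub_mul, ← nCtr_mul_sp M M₀ μ, crep_mul_scale (sp_pos M M₀ μ), abs_mul,
    abs_of_pos (sp_pos M M₀ μ), ← abs_crep_intCast_eq_circAbs (one_le_nCtr M M₀ μ)]
  push_cast
  ring_nf

variable {M₀}

/-- **the index distance of two centres is at most `2/M₀` times their torus distance**: `tdist z z′ ≤ (2/M₀)·dist (ctr z) (ctr z′)`
(axes with one centre contribute `0`). [cite: Balaban1984PropagatorsI, p.36 (|z₁ − z₂|), (1.131) p.38] -/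
theorem tdist_le_dist_ctr (hM₀ : 1 ≤ M₀) (z z' : Cen M M₀) :
    tdist (nCtr M M₀) z z' ≤ 2 / M₀ * dist (ctr M M₀ z) (ctr M M₀ z') := by
  have hM0 : (0 : ℝ) < M₀ := by exact_mod_cast hM₀
  unfold tdist
  rcases isEmpty_or_nonempty (Fin d) with hd | hd
  · rw [Finset.univ_eq_empty, Finset.sup_empty, bot_eq_zero, Nat.cast_zero]
    have := dist_nonneg (x := ctr M M₀ z) (y := ctr M M₀ z')
    positivity
  · obtain ⟨μ, -, hμ⟩ := Finset.exists_mem_eq_sup (Finset.univ : Finset (Fin d)) Finset.univ_nonempty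
      (ccoord (nCtr M M₀) z z')
    rw [hμ]
    have hc : ((ccoord (nCtr M M₀) z z' μ : ℕ) : ℝ) = (circAbs (nCtr M M₀ μ) (((z μ).val : ℤ) - ((z' μ).val : ℤ)) : ℝ) := by
      have := ccoord_cast (fun μ => one_le_nCtr M M₀ μ) z z' μ
      exact_mod_cast this
    rw [hc]
    have key := abs_crep_sub_le_dist M (ctr M M₀ z) (ctr M M₀ z') μ
    rw [cdist_ctr_eq M M₀ z z' μ] at key
    -- either one centre on this axis (distance 0) or spacing ≥ M₀/2
    rcases Nat.lt_or_ge (nCtr M M₀ μ) 2 with h1 | h2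
    · have h1' : nCtr M M₀ μ = 1 := by have := one_le_nCtr M M₀ μ; omega
      have hz : (z μ).val = 0 := by have := (z μ).isLt; omega
      have hz' : (z' μ).val = 0 := by have := (z' μ).isLt; omega
      rw [hz, hz', sub_self, circAbs_zero]
      push_cast
      positivity
    · have hs := half_le_sp M hM₀ h2
      have hc0 : (0 : ℝ) ≤ (circAbs (nCtr M M₀ μ) (((z μ).val : ℤ) - ((z' μ).val : ℤ)) : ℝ) := by
        exact_mod_cast circAbs_nonneg (one_le_nCtr M M₀ μ) _
      calc (circAbs (nCtr M M₀ μ) (((z μ).val : ℤ) - ((z' μ).val : ℤ)) : ℝ)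
          = 2 / M₀ * ((M₀ : ℝ) / 2 * (circAbs (nCtr M M₀ μ) (((z μ).val : ℤ) - ((z' μ).val : ℤ)) : ℝ)) := by
            field_simp
        _ ≤ 2 / M₀ * (sp M M₀ μ * (circAbs (nCtr M M₀ μ) (((z μ).val : ℤ) - ((z' μ).val : ℤ)) : ℝ)) := by
            gcongr
        _ ≤ 2 / M₀ * dist (ctr M M₀ z) (ctr M M₀ z') := by gcongr

/-- **ROW SUMS OVER THE CENTRES, UNIFORM IN THE TORUS AND IN `M₀`**: `Σ_{z′} e^{−dist(ctr z, ctr z′)/(2M₀)} ≤ K_d(¼)` — the field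
`hrow` of `B5Local114.Realisation` (the factor Σ_{z′} e^{−δ₀|z−z′|} under the sum of (1.131), p. 38, at `δ₀M₀ = ½`; its evaluation as the
Z^d row sum `Σ_{x∈Z^d} e^{−δ₀M₀|x|}` is OURS, as in `B5Walk131.row_sum_le_lattice`).
[cite: Balaban1984PropagatorsI, (1.131) p.38] -/
theorem rowSum_ctr_le (hM₀ : 1 ≤ M₀) (z : Cen M M₀) :
    ∑ z' : Cen M M₀, Real.exp (-((2 * (M₀ : ℝ))⁻¹ * dist (ctr M M₀ z) (ctr M M₀ z'))) ≤ latticeConst d (1 / 4) := by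
  have hM0 : (0 : ℝ) < M₀ := by exact_mod_cast hM₀
  have h := rowSum_finset_le (fun μ => one_le_nCtr M M₀ μ) (by norm_num : (0:ℝ) < 1 / 4) Finset.univ z
  refine le_trans (Finset.sum_le_sum fun z' _ => Real.exp_le_exp.mpr ?_) h
  have := tdist_le_dist_ctr M hM₀ z z'
  have e : (2 * (M₀ : ℝ))⁻¹ * dist (ctr M M₀ z) (ctr M M₀ z') = 1 / 4 * (2 / M₀ * dist (ctr M M₀ z) (ctr M M₀ z')) := by
    field_simp; ring
  rw [e]
  nlinarith

/-- **AT MOST `(8c̄ + 1)^d` CUBE CENTRES WITHIN `c̄M₀` OF ANY POINT** — the field `hν` of `B5Local114.Realisation` (OUR evaluation of the multiplicity entering the O(1) of (1.131), p. 38; p. 39 «an absolute constant depending on d only»)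
uniformly in the torus, in `M₀ ≥ 1` and in the point. [cite: Balaban1984PropagatorsI, (1.131) p.38, p.36 (the cubes □_z cover T_η)] -/
theorem card_near_ctr_le (hM₀ : 1 ≤ M₀) {cbar : ℝ} (hc : 0 ≤ cbar) (u : TorR M) :
    ((Finset.univ.filter fun z : Cen M M₀ => dist u (ctr M M₀ z) ≤ cbar * M₀).card : ℝ) ≤ (8 * cbar + 1) ^ d := by
  have hM0 : (0 : ℝ) < M₀ := by exact_mod_cast hM₀
  set F := Finset.univ.filter fun z : Cen M M₀ => dist u (ctr M M₀ z) ≤ cbar * M₀ with hF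
  rcases F.eq_empty_or_nonempty with h0 | ⟨z₀, hz₀⟩
  · rw [h0, Finset.card_empty, Nat.cast_zero]; positivity
  · have hz₀' : dist u (ctr M M₀ z₀) ≤ cbar * M₀ := (Finset.mem_filter.mp hz₀).2
    -- every near centre is within index distance `4c̄` of `z₀`
    have hsub : F ⊆ Finset.univ.filter fun z : Cen M M₀ => tdist (nCtr M M₀) z₀ z ≤ 4 * cbar := by
      intro z hz
      have hz' : dist u (ctr M M₀ z) ≤ cbar * M₀ := (Finset.mem_filter.mp hz).2
      rw [Finset.mem_filter]
      refine ⟨Finset.mem_univ _, ?_⟩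
      have hd : dist (ctr M M₀ z₀) (ctr M M₀ z) ≤ 2 * (cbar * M₀) := by
        calc dist (ctr M M₀ z₀) (ctr M M₀ z) ≤ dist (ctr M M₀ z₀) u + dist u (ctr M M₀ z) := dist_triangle _ _ _
          _ ≤ cbar * M₀ + cbar * M₀ := add_le_add (by rw [dist_comm]; exact hz₀') hz'
          _ = 2 * (cbar * M₀) := by ring
      calc tdist (nCtr M M₀) z₀ z ≤ 2 / M₀ * dist (ctr M M₀ z₀) (ctr M M₀ z) := tdist_le_dist_ctr M hM₀ z₀ z
        _ ≤ 2 / M₀ * (2 * (cbar * M₀)) := by gcongr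
        _ = 4 * cbar := by field_simp; ring
    have hball := ballCard_le_real (fun μ => one_le_nCtr M M₀ μ) z₀ (by positivity : (0:ℝ) ≤ 4 * cbar)
    have hfl : (⌊4 * cbar⌋₊ : ℝ) ≤ 4 * cbar := Nat.floor_le (by positivity)
    calc (F.card : ℝ) ≤ ((Finset.univ.filter fun z : Cen M M₀ => tdist (nCtr M M₀) z₀ z ≤ 4 * cbar).card : ℝ) := by
          exact_mod_cast Finset.card_le_card hsub
      _ ≤ (2 * ⌊4 * cbar⌋₊ + 1 : ℝ) ^ d := hball
      _ ≤ (8 * cbar + 1) ^ d := by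
          apply pow_le_pow_left₀ (by positivity)
          linarith

end Centres

end

end Literature.MathematicalPhysics.QuantumFieldTheory.Balaban1983to89.B5WalkTorusGeom
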